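import Summits.CriticalPhenomena.PercolationContinuityZ3.Theorems.SahiBoxTP2Positivity

/-!
# Box-TP₂: invariance under order isomorphisms, products, marginals; the unit square in pair form

Support file of the Sahi cell (`prim-sahi`, typer seat, generation 11; `--supports stmt-CriticalPhenomena-4575`).
Closure properties of `SahiBoxTP2Split.IsBoxTP2` (all elementary):

* `IsBoxTP2.map_orderIso` — invariance under measurable order isomorphisms of lattices (boxes pull back to boxes,
  meets/joins are preserved);
* `IsBoxTP2.prod` — the product of two box-TP₂ measures is box-TP₂ on the product lattice (so e.g. a singular box-TP₂
  law on `[0,1]²` times any law on `[0,1]` gives new box-TP₂ laws on `[0,1]² × [0,1]`);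
* `IsBoxTP2.fst`, `IsBoxTP2.snd` — marginals on the factors of a product lattice are box-TP₂;
* **`msahiE_nonneg_of_isBoxTP2_unitSquare(_antitone)`** — every box-TP₂ probability measure on the unit square
  `I × I` (pair form) is Sahi-positive of EVERY order for all measurable nonnegative monotone families (transport
  along `(Fin 2 → I) ≃ I × I` + Lieb–Sahi's `L(2,n)`; generation 10 obtained the same conclusion from the weaker
  cut-TP₂ hypothesis — this is the clean box form).

No sorries, no new axioms.
-/

noncomputable section

namespace Summit.CriticalPhenomena.PercolationContinuityZ3.Theorems.SahiBoxTP2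

open MeasureTheory ProbabilityTheory Set Filter Topology Function Literature.Combinatorics.Sahi2008
open scoped ENNReal unitInterval

/-! ### Order isomorphisms, products, marginals -/

/-- **Box-TP₂ is invariant under measurable order isomorphisms of lattices.** [folklore] -/
theorem IsBoxTP2.map_orderIso {β γ : Type*} [Lattice β] [Lattice γ] [MeasurableSpace β] [MeasurableSpace γ]
    {μ : Measure β} (hμ : IsBoxTP2 μ) (e : β ≃o γ) (he : MeasurableEmbedding e) : IsBoxTP2 (μ.map e) := by
  intro a b a' b'
  rw [he.map_apply, he.map_apply, he.map_apply, he.map_apply, e.preimage_Icc, e.preimage_Icc, e.preimage_Icc,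
    e.preimage_Icc, e.symm.map_inf, e.symm.map_inf, e.symm.map_sup, e.symm.map_sup]
  exact hμ _ _ _ _

/-- **Products of box-TP₂ measures are box-TP₂** (product lattice, coordinatewise boxes). [folklore] -/
theorem IsBoxTP2.prod {β γ : Type*} [Lattice β] [Lattice γ] [MeasurableSpace β] [MeasurableSpace γ]
    {μ : Measure β} {ν : Measure γ} [SFinite ν] (hμ : IsBoxTP2 μ) (hν : IsBoxTP2 ν) : IsBoxTP2 (μ.prod ν) := by
  intro p q p' q'
  rw [← Prod.mk.eta (p := p), ← Prod.mk.eta (p := q), ← Prod.mk.eta (p := p'), ← Prod.mk.eta (p := q')]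
  simp only [Prod.mk_inf_mk, Prod.mk_sup_mk, ← Icc_prod_Icc, Measure.prod_prod]
  calc μ (Icc p.1 q.1) * ν (Icc p.2 q.2) * (μ (Icc p'.1 q'.1) * ν (Icc p'.2 q'.2))
      = (μ (Icc p.1 q.1) * μ (Icc p'.1 q'.1)) * (ν (Icc p.2 q.2) * ν (Icc p'.2 q'.2)) := mul_mul_mul_comm _ _ _ _
    _ ≤ (μ (Icc (p.1 ⊓ p'.1) (q.1 ⊓ q'.1)) * μ (Icc (p.1 ⊔ p'.1) (q.1 ⊔ q'.1))) *
          (ν (Icc (p.2 ⊓ p'.2) (q.2 ⊓ q'.2)) * ν (Icc (p.2 ⊔ p'.2) (q.2 ⊔ q'.2))) :=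
        mul_le_mul' (hμ _ _ _ _) (hν _ _ _ _)
    _ = μ (Icc (p.1 ⊓ p'.1) (q.1 ⊓ q'.1)) * ν (Icc (p.2 ⊓ p'.2) (q.2 ⊓ q'.2)) *
          (μ (Icc (p.1 ⊔ p'.1) (q.1 ⊔ q'.1)) * ν (Icc (p.2 ⊔ p'.2) (q.2 ⊔ q'.2))) := mul_mul_mul_comm _ _ _ _

/-- **The first marginal of a box-TP₂ measure on a product lattice is box-TP₂** (second factor bounded).
[folklore] -/
theorem IsBoxTP2.fst {β γ : Type*} [Lattice β] [Lattice γ] [BoundedOrder γ] [MeasurableSpace β]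
    [MeasurableSpace γ] [TopologicalSpace β] [OrderClosedTopology β] [OpensMeasurableSpace β] {μ : Measure (β × γ)}
    (hμ : IsBoxTP2 μ) : IsBoxTP2 μ.fst := by
  intro a b a' b'
  have h : ∀ a b : β, μ.fst (Icc a b) = μ (Icc (a, ⊥) (b, ⊤)) := fun a b => by
    rw [Measure.fst_apply measurableSet_Icc, ← Set.prod_univ, ← Set.Icc_bot_top, Icc_prod_Icc]
  rw [h, h, h, h]
  have key := hμ (a, ⊥) (b, ⊤) (a', ⊥) (b', ⊤)
  simp only [Prod.mk_inf_mk, Prod.mk_sup_mk, bot_inf_eq, top_inf_eq, bot_sup_eq, top_sup_eq] at key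
  exact key

/-- **The second marginal of a box-TP₂ measure on a product lattice is box-TP₂** (first factor bounded).
[folklore] -/
theorem IsBoxTP2.snd {β γ : Type*} [Lattice β] [Lattice γ] [BoundedOrder β] [MeasurableSpace β]
    [MeasurableSpace γ] [TopologicalSpace γ] [OrderClosedTopology γ] [OpensMeasurableSpace γ] {μ : Measure (β × γ)}
    (hμ : IsBoxTP2 μ) : IsBoxTP2 μ.snd := by
  intro a b a' b'
  have h : ∀ a b : γ, μ.snd (Icc a b) = μ (Icc (⊥, a) (⊤, b)) := fun a b => by
    rw [Measure.snd_apply measurableSet_Icc, ← Set.univ_prod, ← Set.Icc_bot_top, Icc_prod_Icc]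
  rw [h, h, h, h]
  have key := hμ (⊥, a) (⊤, b) (⊥, a') (⊤, b')
  simp only [Prod.mk_inf_mk, Prod.mk_sup_mk, bot_inf_eq, top_inf_eq, bot_sup_eq, top_sup_eq] at key
  exact key

/-! ### The unit square in pair form -/

/-- A box-TP₂ law on `I × I`, read on `Fin 2 → I`, is box-TP₂ (transport along `finTwoArrow`). [folklore] -/
theorem IsBoxTP2.map_finTwoArrow_symm {μ : Measure (I × I)} (hμ : IsBoxTP2 μ) :
    IsBoxTP2 (μ.map (MeasurableEquiv.finTwoArrow : (Fin 2 → I) ≃ᵐ I × I).symm) :=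
  hμ.map_orderIso (OrderIso.finTwoArrowIso I).symm
    (MeasurableEquiv.finTwoArrow : (Fin 2 → I) ≃ᵐ I × I).symm.measurableEmbedding

/-- **Every box-TP₂ probability measure on the unit square `[0,1] × [0,1]` is Sahi-positive of EVERY order** for all
measurable nonnegative monotone families (no density, no continuity; Lieb–Sahi's `L(2,n)` behind the coupling).
[this work] -/
theorem msahiE_nonneg_of_isBoxTP2_unitSquare (μ : Measure (I × I)) [IsProbabilityMeasure μ] (hμ : IsBoxTP2 μ)
    (n : ℕ) (f : Fin n → I × I → ℝ) (hfm : ∀ i, Measurable (f i)) (hf0 : ∀ i p, 0 ≤ f i p)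
    (hmono : ∀ i, Monotone (f i)) : 0 ≤ msahiE μ n f := by
  set e := (MeasurableEquiv.finTwoArrow : (Fin 2 → I) ≃ᵐ I × I) with he
  haveI : IsProbabilityMeasure (μ.map e.symm) := Measure.isProbabilityMeasure_map e.symm.measurable.aemeasurable
  obtain ⟨G, S, hGm, hS, hG, hGμ⟩ := exists_aemonotone_coupling 2 (μ.map e.symm) hμ.map_finTwoArrow_symm
  have hμ' : μ = (volume : Measure (Fin 2 → I)).map (e ∘ G) := by
    rw [← Measure.map_map e.measurable hGm, hGμ, Measure.map_map e.measurable e.symm.measurable, e.self_comp_symm,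
      Measure.map_id]
  have hemono : Monotone e := fun x y hxy => (OrderIso.finTwoArrowIso I).monotone hxy
  rw [hμ']
  exact msahiE_map_nonneg_of_liebSahiContinuum_of_monotoneOn (liebSahiContinuum_two n) (e.measurable.comp hGm) hS
    (fun x hx y hy hxy => hemono (hG hx hy hxy)) f hfm hf0 (fun i => f i ⊤) (fun i p => hmono i le_top) hmono

/-- The same for measurable nonnegative ANTITONE families. [this work] -/
theorem msahiE_nonneg_of_isBoxTP2_unitSquare_antitone (μ : Measure (I × I)) [IsProbabilityMeasure μ]
    (hμ : IsBoxTP2 μ) (n : ℕ) (f : Fin n → I × I → ℝ) (hfm : ∀ i, Measurable (f i)) (hf0 : ∀ i p, 0 ≤ f i p)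
    (hanti : ∀ i, Antitone (f i)) : 0 ≤ msahiE μ n f := by
  set e := (MeasurableEquiv.finTwoArrow : (Fin 2 → I) ≃ᵐ I × I) with he
  haveI : IsProbabilityMeasure (μ.map e.symm) := Measure.isProbabilityMeasure_map e.symm.measurable.aemeasurable
  obtain ⟨G, S, hGm, hS, hG, hGμ⟩ := exists_aemonotone_coupling 2 (μ.map e.symm) hμ.map_finTwoArrow_symm
  have hμ' : μ = (volume : Measure (Fin 2 → I)).map (e ∘ G) := by
    rw [← Measure.map_map e.measurable hGm, hGμ, Measure.map_map e.measurable e.symm.measurable, e.self_comp_symm,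
      Measure.map_id]
  have hemono : Monotone e := fun x y hxy => (OrderIso.finTwoArrowIso I).monotone hxy
  rw [hμ']
  exact msahiE_map_nonneg_of_liebSahiContinuum_of_monotoneOn_antitone (liebSahiContinuum_two n)
    (e.measurable.comp hGm) hS (fun x hx y hy hxy => hemono (hG hx hy hxy)) f hfm hf0 (fun i => f i ⊥)
    (fun i p => hanti i bot_le) hanti

/-! ### Conditioning on a closed box -/

/-- **Box-TP₂ is preserved by restriction to a closed box** (conditioning on `[p,q]`, e.g. truncated Gaussians with
M-matrix precision): on a distributive lattice `[a,b] ∩ [p,q] = [a ∨ p, b ∧ q]` and the truncated corners still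
satisfy the meet/join identities. [folklore] -/
theorem IsBoxTP2.restrict_Icc {β : Type*} [DistribLattice β] [MeasurableSpace β] [TopologicalSpace β]
    [OrderClosedTopology β] [OpensMeasurableSpace β] {μ : Measure β} (hμ : IsBoxTP2 μ) (p q : β) :
    IsBoxTP2 (μ.restrict (Icc p q)) := by
  have hI : ∀ a b : β, Icc a b ∩ Icc p q = Icc (a ⊔ p) (b ⊓ q) := fun a b => Icc_inter_Icc
  intro a b a' b'
  rw [Measure.restrict_apply measurableSet_Icc, Measure.restrict_apply measurableSet_Icc,
    Measure.restrict_apply measurableSet_Icc, Measure.restrict_apply measurableSet_Icc, hI, hI, hI, hI]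
  have key := hμ (a ⊔ p) (b ⊓ q) (a' ⊔ p) (b' ⊓ q)
  rwa [← sup_inf_right, ← inf_inf_distrib_right, ← sup_sup_distrib_right, ← inf_sup_right] at key

/-- Normalised conditioning on a closed box of positive finite mass preserves box-TP₂ (scalar multiples do).
[folklore] -/
theorem IsBoxTP2.smul {β : Type*} [Lattice β] [MeasurableSpace β] {μ : Measure β} (hμ : IsBoxTP2 μ) (c : ℝ≥0∞) :
    IsBoxTP2 (c • μ) := by
  intro a b a' b'
  simp only [Measure.smul_apply, smul_eq_mul]
  calc c * μ (Icc a b) * (c * μ (Icc a' b')) = c * c * (μ (Icc a b) * μ (Icc a' b')) := by ring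
    _ ≤ c * c * (μ (Icc (a ⊓ a') (b ⊓ b')) * μ (Icc (a ⊔ a') (b ⊔ b'))) := mul_le_mul' le_rfl (hμ a b a' b')
    _ = c * μ (Icc (a ⊓ a') (b ⊓ b')) * (c * μ (Icc (a ⊔ a') (b ⊔ b'))) := by ring

end Summit.CriticalPhenomena.PercolationContinuityZ3.Theorems.SahiBoxTP2
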